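import Mathlib.InformationTheory.KullbackLeibler.Basic
import Literature.MathematicalPhysics.KineticTheory.HardSphereEulerProofs
import Literature.Analysis.FluidPDE.HardSphereDynamicsProofs
import Summits.AtomisticToContinuum.HydrodynamicLimit.Theorems.KineticWindowGronwall.Negative.ActivityDummy
import HarnessLib

/-!
# Stub `stub_ledger` of the line `IdeatorTwoSketch` (crux `MacroClosure`), part 1: scaling and
the positive Gibbs density

Support file (`--supports stmt-AtomisticToContinuum-14870`) for the registered stub
`stub_ledger : LedgerIdentity` of the lead skeleton (vocabulary in
`CollisionIsometryCLTMacroClosureDefs`; the statements below are written with that vocabulary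
UNFOLDED — `Flow σ N = HardSphereFlow (Torus.geometry (Fin 3)) (hsDiameter σ N) (N + 1)`,
`Zpart σ N a u θ = canonicalPartition _ (hsDiameter σ N) (N + 1) (localGibbsProfile a u θ)`,
`logProfilePair a u θ z = ∫ y, log (localGibbsProfile a u θ y) ∂(empiricalMeasure z)` — so that this
file does not depend on the definitions module). This part proves:

* (L0) `localGibbsLaw_const_mul` — the canonical local Gibbs law is invariant under scaling of
  the activity `a ↦ c • a`, `c > 0` (the factor `c^(N+1)` cancels between `tensorPow` and
  `canonicalPartition`: `canonicalDensity_const_mul` of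
  `Theorems/KineticWindowGronwall/Negative/ActivityDummy.lean`, imported);
* `localGibbsLaw_eq_particleLaw_tensorPow` — the local Gibbs law is the particle law of the
  EVERYWHERE POSITIVE density `Z⁻¹ ∏ₖ prof(zₖ)` (the hard-sphere indicator of `canonicalDensity`
  is invisible on `liouville = volume.restrict D_ε`);
* the finite-`N` bookkeeping of that density: `log (Z⁻¹ ∏ₖ prof(zₖ)) = (N+1)·⟨emp z, log prof⟩ − log Z`,
  positivity of the partition function `Z` for `σ ≤ 1/2`, the quadratic velocity bound
  `|log prof(x,v)| ≤ C(1 + |v|²)` for continuous positive parameters on the compact torus, and the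
  resulting domination `|⟨emp z, log prof⟩| ≤ C (1 + ⟨emp z, |v|²⟩)` with measurability.

No new definitions; all objects are the tree's (`localGibbsLaw`, `canonicalDensity`,
`canonicalPartition`, `tensorPow`, `empiricalMeasure`, `localGibbsProfile`).
-/

noncomputable section

open MeasureTheory Filter Set Topology InformationTheory
open scoped ENNReal ContDiff

namespace Summit.AtomisticToContinuum.HydrodynamicLimit.Theorems.MacroClosureLine

open Literature.MathematicalPhysics.KineticTheory Literature.Analysis.FluidPDE
open Literature.Analysis.FunctionSpaces

namespace StubLedger

/-! ## (L0) Activity scaling -/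

/-- Scaling the activity scales the local Gibbs profile: `prof_{c a} = c · prof_a`. [folklore] -/
theorem localGibbsProfile_const_mul (c : ℝ) (a θ : T3 → ℝ) (u : T3 → V3) :
    localGibbsProfile (fun x => c * a x) u θ = fun y => c * localGibbsProfile a u θ y := by
  funext y
  simp [localGibbsProfile, mul_assoc]

/-- **(L0)** The canonical local Gibbs law is invariant under scaling of the activity by a
positive constant. [folklore] -/
theorem localGibbsLaw_const_mul {σ : ℝ} {N : ℕ}
    (Φ : HardSphereFlow (Torus.geometry (Fin 3)) (hsDiameter σ N) (N + 1)) (a θ : T3 → ℝ)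
    (u : T3 → V3) {c : ℝ} (hc : 0 < c) :
    localGibbsLaw σ (fun x => c * a x) u θ N Φ = localGibbsLaw σ a u θ N Φ := by
  unfold localGibbsLaw
  rw [localGibbsProfile_const_mul]
  congr 1
  funext z
  exact KineticWindowGronwallNegative.canonicalDensity_const_mul hc.ne' _ _ z

/-! ## The positive Gibbs density -/

/-- The local Gibbs law is the particle law of the everywhere positive density
`Z⁻¹ ∏ₖ prof(zₖ)` w.r.t. the Liouville measure: on `liouville = volume.restrict D_ε` the indicator
in `canonicalDensity` is invisible. [folklore] -/
theorem localGibbsLaw_eq_particleLaw_tensorPow {σ : ℝ} {N : ℕ}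
    (Φ : HardSphereFlow (Torus.geometry (Fin 3)) (hsDiameter σ N) (N + 1)) (a θ : T3 → ℝ)
    (u : T3 → V3) :
    localGibbsLaw σ a u θ N Φ = particleLaw Φ fun z =>
      (canonicalPartition (Torus.geometry (Fin 3)) (hsDiameter σ N) (N + 1) (localGibbsProfile a u θ))⁻¹ *
        tensorPow (N + 1) (localGibbsProfile a u θ) z := by
  rw [localGibbsLaw, particleLaw_eq, particleLaw_eq]
  refine withDensity_congr_ae ?_
  rw [liouville_eq]
  filter_upwards [ae_restrict_mem
    (measurableSet_hardSphereDomain _ Torus.measurable_geometry_sepVec _ _)] with z hz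
  rw [canonicalDensity, Set.indicator_of_mem hz]

/-- The local Gibbs profile is everywhere positive for `a, θ > 0`. [folklore] -/
theorem localGibbsProfile_pos {a θ : T3 → ℝ} {u : T3 → V3} (ha : ∀ x, 0 < a x)
    (hθ : ∀ x, 0 < θ x) (y : T3 × V3) : 0 < localGibbsProfile a u θ y :=
  mul_pos (ha _) (localMaxwellian_pos one_pos (hθ _) _ _)

/-- The canonical partition function of the local Gibbs profile of a continuous positive parameter
triple is positive for `σ ≤ 1/2` (it is the configurational one, `posPartition_pos`). [folklore] -/
theorem canonicalPartition_localGibbs_pos {σ : ℝ} (hσ2 : σ ≤ 1 / 2) (N : ℕ) {a θ : T3 → ℝ}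
    {u : T3 → V3} (ha : Continuous a) (hθ : Continuous θ) (hu : Continuous u) (ha0 : ∀ x, 0 < a x)
    (hθ0 : ∀ x, 0 < θ x) :
    0 < canonicalPartition (Torus.geometry (Fin 3)) (hsDiameter σ N) (N + 1) (localGibbsProfile a u θ) := by
  rw [canonicalPartition_eq_posPartition ha hθ hu (fun x => (ha0 x).le) hθ0]
  exact posPartition_pos ha ha0 hσ2 N

/-- The positive Gibbs density is positive. [folklore] -/
theorem gibbsDensity_pos {σ : ℝ} (hσ2 : σ ≤ 1 / 2) (N : ℕ) {a θ : T3 → ℝ} {u : T3 → V3}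
    (ha : Continuous a) (hθ : Continuous θ) (hu : Continuous u) (ha0 : ∀ x, 0 < a x)
    (hθ0 : ∀ x, 0 < θ x) (z : Config (N + 1) (Fin 3) T3) :
    0 < (canonicalPartition (Torus.geometry (Fin 3)) (hsDiameter σ N) (N + 1) (localGibbsProfile a u θ))⁻¹ *
      tensorPow (N + 1) (localGibbsProfile a u θ) z :=
  mul_pos (inv_pos.2 (canonicalPartition_localGibbs_pos hσ2 N ha hθ hu ha0 hθ0))
    (Finset.prod_pos fun k _ => localGibbsProfile_pos ha0 hθ0 (z k))

/-- The positive Gibbs density is measurable. [folklore] -/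
theorem measurable_gibbsDensity (σ : ℝ) (N : ℕ) {a θ : T3 → ℝ} {u : T3 → V3}
    (ha : Continuous a) (hθ : Continuous θ) (hu : Continuous u) :
    Measurable fun z : Config (N + 1) (Fin 3) T3 =>
      (canonicalPartition (Torus.geometry (Fin 3)) (hsDiameter σ N) (N + 1) (localGibbsProfile a u θ))⁻¹ *
        tensorPow (N + 1) (localGibbsProfile a u θ) z :=
  measurable_const.mul (measurable_tensorPow (measurable_localGibbsProfile ha hθ hu) _)

/-! ## Empirical pairings as averages -/

/-- The empirical log-profile pairing is the average `(N+1)⁻¹ ∑ₖ log prof(zₖ)`. [folklore] -/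
theorem logPair_eq_sum {N : ℕ} (a θ : T3 → ℝ) (u : T3 → V3)
    (z : Config (N + 1) (Fin 3) T3) :
    (∫ y, Real.log (localGibbsProfile a u θ y) ∂(empiricalMeasure z)) =
      ((N : ℝ) + 1)⁻¹ * ∑ k, Real.log (localGibbsProfile a u θ (z k)) := by
  rw [integral_empiricalMeasure]
  push_cast
  rfl

/-- The empirical kinetic energy pairing is the average `(N+1)⁻¹ ∑ₖ |vₖ|²`. [folklore] -/
theorem kineticPair_eq_sum {N : ℕ} (z : Config (N + 1) (Fin 3) T3) :
    ∫ y, ‖y.2‖ ^ 2 ∂(empiricalMeasure z) = ((N : ℝ) + 1)⁻¹ * ∑ k, ‖(z k).2‖ ^ 2 := by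
  rw [integral_empiricalMeasure]
  push_cast
  rfl

/-- The logarithm of the positive Gibbs density is `(N+1)·⟨emp z, log prof⟩ − log Z`. [folklore] -/
theorem log_gibbsDensity {σ : ℝ} (hσ2 : σ ≤ 1 / 2) (N : ℕ) {a θ : T3 → ℝ} {u : T3 → V3}
    (ha : Continuous a) (hθ : Continuous θ) (hu : Continuous u) (ha0 : ∀ x, 0 < a x)
    (hθ0 : ∀ x, 0 < θ x) (z : Config (N + 1) (Fin 3) T3) :
    Real.log ((canonicalPartition (Torus.geometry (Fin 3)) (hsDiameter σ N) (N + 1) (localGibbsProfile a u θ))⁻¹ *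
        tensorPow (N + 1) (localGibbsProfile a u θ) z) =
      ((N : ℝ) + 1) * (∫ y, Real.log (localGibbsProfile a u θ y) ∂(empiricalMeasure z)) -
        Real.log (canonicalPartition (Torus.geometry (Fin 3)) (hsDiameter σ N) (N + 1) (localGibbsProfile a u θ)) := by
  have hZ := canonicalPartition_localGibbs_pos hσ2 N ha hθ hu ha0 hθ0
  have hp : ∀ k, localGibbsProfile a u θ (z k) ≠ 0 :=
    fun k => (localGibbsProfile_pos ha0 hθ0 _).ne'
  simp only [tensorPow]
  rw [Real.log_mul (inv_ne_zero hZ.ne') (Finset.prod_ne_zero_iff.2 fun k _ => hp k), Real.log_inv,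
    Real.log_prod fun k _ => hp k, logPair_eq_sum, ← mul_assoc,
    mul_inv_cancel₀ (by positivity), one_mul]
  ring

/-- The logarithm of the positive Gibbs density is measurable. [folklore] -/
theorem measurable_logPair {N : ℕ} {a θ : T3 → ℝ} {u : T3 → V3}
    (ha : Continuous a) (hθ : Continuous θ) (hu : Continuous u) :
    Measurable fun z : Config (N + 1) (Fin 3) T3 =>
      (∫ y, Real.log (localGibbsProfile a u θ y) ∂(empiricalMeasure z)) := by
  simp_rw [logPair_eq_sum]
  refine measurable_const.mul (Finset.measurable_sum _ fun k _ => ?_)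
  exact Real.measurable_log.comp ((measurable_localGibbsProfile ha hθ hu).comp (measurable_pi_apply k))

/-! ## The quadratic velocity bound on the log-profile -/

/-- The log-profile in coordinates: `log prof(x,v) = log a(x) + log (2πθ(x))^{-3/2} − |v − u(x)|²/(2θ(x))`.
[folklore] -/
theorem log_localGibbsProfile_eq {a θ : T3 → ℝ} {u : T3 → V3} (x : T3) (v : V3) (ha : 0 < a x)
    (hθ : 0 < θ x) :
    Real.log (localGibbsProfile a u θ (x, v)) =
      Real.log (a x) + Real.log ((2 * Real.pi * θ x) ^ (-(Module.finrank ℝ V3 : ℝ) / 2)) -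
        ‖v - u x‖ ^ 2 / (2 * θ x) := by
  simp only [localGibbsProfile, localMaxwellian, one_mul]
  have h1 : 0 < (2 * Real.pi * θ x) ^ (-(Module.finrank ℝ V3 : ℝ) / 2) :=
    Real.rpow_pos_of_pos (mul_pos (mul_pos two_pos Real.pi_pos) hθ) _
  rw [Real.log_mul ha.ne' (mul_pos h1 (Real.exp_pos _)).ne', Real.log_mul h1.ne' (Real.exp_pos _).ne',
    Real.log_exp]
  ring

/-- **Quadratic velocity bound.** For continuous parameters `a, θ > 0`, `u` on the compact torus
there is `C` with `|log prof(x, v)| ≤ C (1 + |v|²)`. [folklore] -/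
theorem exists_abs_log_localGibbsProfile_le {a θ : T3 → ℝ} {u : T3 → V3} (ha : Continuous a)
    (hθ : Continuous θ) (hu : Continuous u) (ha0 : ∀ x, 0 < a x) (hθ0 : ∀ x, 0 < θ x) :
    ∃ C : ℝ, 0 ≤ C ∧ ∀ x v, |Real.log (localGibbsProfile a u θ (x, v))| ≤ C * (1 + ‖v‖ ^ 2) := by
  obtain ⟨C₁, hC₁, h₁⟩ := exists_forall_abs_le_of_continuous (ha.log fun x => (ha0 x).ne')
  have hRc : Continuous fun x => (2 * Real.pi * θ x) ^ (-(Module.finrank ℝ V3 : ℝ) / 2) :=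
    (continuous_const.mul hθ).rpow_const fun x =>
      Or.inl (mul_pos (mul_pos two_pos Real.pi_pos) (hθ0 x)).ne'
  obtain ⟨C₂, hC₂, h₂⟩ := exists_forall_abs_le_of_continuous (hRc.log fun x =>
    (Real.rpow_pos_of_pos (mul_pos (mul_pos two_pos Real.pi_pos) (hθ0 x)) _).ne')
  obtain ⟨C₃, hC₃, h₃⟩ := exists_forall_abs_le_of_continuous (χ := fun x => (2 * θ x)⁻¹)
    ((continuous_const.mul hθ).inv₀ fun x => (mul_pos two_pos (hθ0 x)).ne')
  obtain ⟨C₄, hC₄, h₄⟩ := exists_forall_abs_le_of_continuous hu.norm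
  refine ⟨C₁ + C₂ + C₃ * (2 + 2 * C₄ ^ 2), by positivity, fun x v => ?_⟩
  rw [log_localGibbsProfile_eq x v (ha0 x) (hθ0 x)]
  have hθ2 : 0 < 2 * θ x := mul_pos two_pos (hθ0 x)
  have hu4 : ‖u x‖ ≤ C₄ := by simpa using h₄ x
  have hquad : ‖v - u x‖ ^ 2 / (2 * θ x) ≤ C₃ * (2 * ‖v‖ ^ 2 + 2 * C₄ ^ 2) := by
    rw [div_eq_inv_mul]
    have h3' : (2 * θ x)⁻¹ ≤ C₃ := (le_abs_self _).trans (h₃ x)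
    have htri : ‖v - u x‖ ≤ ‖v‖ + ‖u x‖ := norm_sub_le v (u x)
    have h1 : ‖v - u x‖ ^ 2 ≤ (‖v‖ + ‖u x‖) ^ 2 := by gcongr
    have h2 : ‖u x‖ ^ 2 ≤ C₄ ^ 2 := by gcongr
    have hsq : ‖v - u x‖ ^ 2 ≤ 2 * ‖v‖ ^ 2 + 2 * C₄ ^ 2 := by
      nlinarith [h1, h2, sq_nonneg (‖v‖ - ‖u x‖)]
    exact mul_le_mul h3' hsq (sq_nonneg _) hC₃
  have hnn : 0 ≤ ‖v - u x‖ ^ 2 / (2 * θ x) := div_nonneg (sq_nonneg _) hθ2.le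
  have hA := abs_le.1 (h₁ x)
  have hB := abs_le.1 (h₂ x)
  rw [abs_le]
  constructor <;> nlinarith [hA.1, hA.2, hB.1, hB.2, hquad, hnn, mul_nonneg hC₁ (sq_nonneg ‖v‖),
    mul_nonneg hC₂ (sq_nonneg ‖v‖), mul_nonneg (mul_nonneg hC₃ (sq_nonneg C₄)) (sq_nonneg ‖v‖),
    mul_nonneg hC₃ (sq_nonneg ‖v‖), hC₃]

/-- **Domination of the log-profile pairing by the kinetic energy**: with the constant of
`exists_abs_log_localGibbsProfile_le`, `|⟨emp z, log prof⟩| ≤ C (1 + ⟨emp z, |v|²⟩)`. [folklore] -/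
theorem abs_logPair_le {N : ℕ} {a θ : T3 → ℝ} {u : T3 → V3} {C : ℝ}
    (hC : ∀ x v, |Real.log (localGibbsProfile a u θ (x, v))| ≤ C * (1 + ‖v‖ ^ 2))
    (z : Config (N + 1) (Fin 3) T3) :
    |∫ y, Real.log (localGibbsProfile a u θ y) ∂(empiricalMeasure z)| ≤
      C * (1 + ∫ y, ‖y.2‖ ^ 2 ∂(empiricalMeasure z)) := by
  rw [logPair_eq_sum, kineticPair_eq_sum, abs_mul, abs_of_nonneg (by positivity)]
  have hN : (0 : ℝ) < (N : ℝ) + 1 := by positivity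
  calc ((N : ℝ) + 1)⁻¹ * |∑ k, Real.log (localGibbsProfile a u θ (z k))|
      ≤ ((N : ℝ) + 1)⁻¹ * ∑ k, C * (1 + ‖(z k).2‖ ^ 2) := by
        refine mul_le_mul_of_nonneg_left ((Finset.abs_sum_le_sum_abs _ _).trans
          (Finset.sum_le_sum fun k _ => ?_)) (inv_nonneg.2 hN.le)
        exact hC (z k).1 (z k).2
    _ = C * (1 + ((N : ℝ) + 1)⁻¹ * ∑ k, ‖(z k).2‖ ^ 2) := by
        rw [← Finset.mul_sum, Finset.sum_add_distrib, Finset.sum_const, Finset.card_univ,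
          Fintype.card_fin, nsmul_eq_mul]
        push_cast
        field_simp

/-- **Integrability of the log-profile pairing along a measurable map** (e.g. the flow at a fixed
time, or the identity): if the kinetic energy `⟨emp (T z), |v|²⟩` is integrable under a finite law
`P`, so is `⟨emp (T ·), log prof⟩`. [folklore] -/
theorem integrable_logPair_comp {N : ℕ} {a θ : T3 → ℝ} {u : T3 → V3} (ha : Continuous a)
    (hθ : Continuous θ) (hu : Continuous u) (ha0 : ∀ x, 0 < a x) (hθ0 : ∀ x, 0 < θ x)
    {P : Measure (Config (N + 1) (Fin 3) T3)} [IsFiniteMeasure P]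
    {T : Config (N + 1) (Fin 3) T3 → Config (N + 1) (Fin 3) T3} (hT : Measurable T)
    (hK : Integrable (fun z => ∫ y, ‖y.2‖ ^ 2 ∂(empiricalMeasure (T z))) P) :
    Integrable (fun z => (∫ y, Real.log (localGibbsProfile a u θ y) ∂(empiricalMeasure (T z))))
      P := by
  obtain ⟨C, -, hC⟩ := exists_abs_log_localGibbsProfile_le ha hθ hu ha0 hθ0
  refine Integrable.mono' ((integrable_const C).add (hK.const_mul C))
    ((measurable_logPair ha hθ hu).comp hT).aestronglyMeasurable
    (ae_of_all _ fun z => ?_)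
  rw [Real.norm_eq_abs]
  calc |(∫ y, Real.log (localGibbsProfile a u θ y) ∂(empiricalMeasure (T z)))|
      ≤ C * (1 + ∫ y, ‖y.2‖ ^ 2 ∂(empiricalMeasure (T z))) := abs_logPair_le hC (T z)
    _ = C + C * ∫ y, ‖y.2‖ ^ 2 ∂(empiricalMeasure (T z)) := by ring

end StubLedger

/-- Registered sub-goal `stub_ledger_scaling` of the stub `stub_ledger`: conjunct (L0), the
canonical local Gibbs law is invariant under scaling of the activity
(`StubLedger.localGibbsLaw_const_mul`). [folklore] -/
theorem stub_ledger_scaling : ∀ (σ : ℝ) (N : ℕ) (Φ : HardSphereFlow (Torus.geometry (Fin 3)) (hsDiameter σ N) (N + 1)) (a θ : T3 → ℝ) (u : T3 → V3) (c : ℝ), 0 < c → localGibbsLaw σ (fun x => c * a x) u θ N Φ = localGibbsLaw σ a u θ N Φ :=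
  fun _ _ Φ a θ u _ hc => StubLedger.localGibbsLaw_const_mul Φ a θ u hc

end Summit.AtomisticToContinuum.HydrodynamicLimit.Theorems.MacroClosureLine

end
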